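/-
Copyright (c) 2026 the pub-hodgecm-mathlib formalisation cell (harness21).  Prover seat hodgecm-mathlib-K2E5-p11 (g2): Track B «K2-LIT», engine E3, line (ii′), leaf (E),
sub-leaf (RAO_z), brick «RAO-CONV_z» — the payer tie; 2026-09-04.
-/
import Literature.NumberTheory.Rogawski1990.TamagawaSingularMembersFinTFCovol   -- ★ frame vocabulary (`IsLocalTransferDatum`, `IsCanonical`, `IsQuotientOf`, `localStableOrbitalIntegral`, …)
import Literature.NumberTheory.Weil1982.UnitaryFinCentralizerTopFormHaar         -- ★ `UnitaryFinTopForm.finTamagawaPartner`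
import Literature.NumberTheory.Rogawski1990.FinExplicitTransferFactorConjLeft     -- ★ `finExplicitDelta_conj_left_all`
import Literature.NumberTheory.Rogawski1990.FinExplicitTransferFactorConjRight    -- ★ `finExplicitDelta_conj_right_all`
import Literature.NumberTheory.Rogawski1990.ArchCanonicalTransferFactor           -- ★ `archCanonicalTransferFactor`
import Literature.NumberTheory.Rogawski1990.ExplicitFactorProductFormula          -- ★ `finExplicitCollection`, `UnitaryGroup.PlacesOver`
import Literature.NumberTheory.Automorphic.QuadraticHeckeCharacterCM              -- ★ `quadraticHeckeCharCM`
import Literature.NumberTheory.Rogawski1990.UnitaryTwoOneCentralUnipotentOrbitFinitenessCM          -- ★ p856153 (this seat, FILE B): the core `UnitaryGroup.measure_preimage_descConj_lt_top_of_coe_eq_lineUnipotent_central`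
import Literature.NumberTheory.Rogawski1990.UnitaryTwoOneCentralUnipotentOrbitalConvergenceOfCoreCM   -- ★ p856112 (K2E3-p23 (g2)): `centralUnipotentOrbitalIntegrable_of_core : ‹CORE_z› → ‹(RAO-CONV_z)›`
import HarnessLib

/-!
# (RAO-CONV_z) `sig_K2E3CentralUnipotentOrbitalConvergence` — PAID OUTRIGHT (K2E5-p11 (g2), with K2E3-p23 (g2)'s adapter ★ p856112)

Cell map: H413 «K2-LIT», E3 line (ii′) «H-side central germ expansion», dealer file `…Sigs_U3bCentralGerms` (ED. 7 hosts (RAO-CONV_z) cand 35641b1af515a2eb), leaf (E)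
`sig_K2E3CentralGermExpansionExistence` ⟸ ★ p855998 ∘ {(RAO_z) ⟸ ★ p856062 ∘ (RAO-CONV_z), (DUAL_z) ★ p855937}.  THIS FILE: the payer head
`centralUnipotentOrbitalConvergence : ‹cand 35641b1af515a2eb bytes VERBATIM›` := ★ p856112 `centralUnipotentOrbitalIntegrable_of_core` (which-class at `N = 2`, the central
one-point class, transport along `IsConj` — K2E3-p23 (g2)) applied to ★ p856153 `UnitaryGroup.measure_preimage_descConj_lt_top_of_coe_eq_lineUnipotent_central` (the `U(1,1)`
Iwasawa covering on `H_v = U(Φ₂) × U(Φ₁)` and Ranga Rao's shell bound — this seat).  RANGA RAO'S CONVERGENCE at every class over a central `z` of `H_v`, μ-generic, HCONV shape.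
THEOREMS ONLY; `--supports stmt-HodgeConjecture-24833 --as helper` (count-neutral).  Tie for the dealer: `sig_K2E3CentralUnipotentOrbitalConvergence :=
…Cruxes.H413.K2E3EllipticInputs.U3bCentralGerms.centralUnipotentOrbitalConvergence`.
HONEST LABEL: HC_CM is proved only modulo the 7 printed citations (2 remaining named inputs: hLiu418 = stmt-HodgeConjecture-24832, h413 = stmt-HodgeConjecture-24833) until rung 0 closes.

## References
* [Rao1972] R. Ranga Rao, *Orbital integrals in reductive groups*, Ann. of Math. (2) 96 (1972) 505–510.
* [Rogawski1990] J. D. Rogawski, *Automorphic Representations of Unitary Groups in Three Variables*, Ann. of Math. Stud. 123 (1990), §3.9 p. 32, §4.9 p. 54, §8.1 p. 112.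
* [HarishChandra1999AdmissibleDistributions] Harish-Chandra, *Admissible Invariant Distributions on Reductive p-adic Groups* (1999), §3.1 p. 17.
-/

set_option autoImplicit false
set_option linter.dupNamespace false

noncomputable section

open Filter Topology
open MeasureTheory Measure NumberField IsDedekindDomain
open Literature.MeasureTheory.Group Literature.MeasureTheory.RestrictedProduct
open Literature.Topology.RestrictedProduct Literature.Topology.Algebra.RestrictedProduct
open Literature.NumberTheory.Rogawski1990 Literature.NumberTheory.Automorphic
open Literature.AlgebraicGeometry.ShimuraVarieties (unitaryGroup hermForm)
open scoped Matrix MatrixGroups RestrictedProduct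

namespace Summit.HodgeConjecture.HodgeConjecture.Cruxes.H413.K2E3EllipticInputs.U3bCentralGerms

/-- **(RAO-CONV_z) RANGA RAO'S CONVERGENCE AT THE CLASSES OVER A CENTRAL `z` OF `H_v = U(Φ₂)(L⁺_v) × U(Φ₁)(L⁺_v)`, μ-GENERIC — PAID.**  Statement = cand
`sig_K2E3CentralUnipotentOrbitalConvergence` 35641b1af515a2eb VERBATIM: for `z ∈ Z(H_v)`, every `γ` over `z` (`((γ z⁻¹).1 − 1)² = 0 ∧ (γ z⁻¹).2 = 1`), every `H_v`-invariant
measure `μ` on `H_v ⧸ Z(γ)` finite on compacta and every `fH ∈ C_c^∞(H_v)`, the orbital integrand `y Z(γ) ↦ fH(y γ y⁻¹)` is `μ`-integrable.  Proof: ★ p856112 (which class ∕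
one-point class ∕ `IsConj` transport, K2E3-p23 (g2)) over ★ p856153 (the Iwasawa covering and Ranga Rao's shell bound at the base points `(u,1)·z`, this seat).
[cite: Rao1972, Theorem] [cite: Rogawski1990, §8.1 p. 112; §4.9 p. 54; §3.9 p. 32; §1.10 p. 9] [cite: HarishChandra1999AdmissibleDistributions, §3.1 p. 17] -/
theorem centralUnipotentOrbitalConvergence :
    ∀ (L : Type) [Field L] [NumberField L] [IsCMField L] (v : HeightOneSpectrum (𝓞 ↥(maximalRealSubfield L)))
      [MeasurableSpace ((UnitaryGroup.cmDatum L 2 (Matrix.of fun i j : Fin 2 => if i.val + j.val + 1 = 2 then (1 : L) else 0)).Local v × (UnitaryGroup.cmDatum L 1 (Matrix.of fun i j : Fin 1 => if i.val + j.val + 1 = 1 then (1 : L) else 0)).Local v)] [BorelSpace ((UnitaryGroup.cmDatum L 2 (Matrix.of fun i j : Fin 2 => if i.val + j.val + 1 = 2 then (1 : L) else 0)).Local v × (UnitaryGroup.cmDatum L 1 (Matrix.of fun i j : Fin 1 => if i.val + j.val + 1 = 1 then (1 : L) else 0)).Local v)]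
      [∀ a : (UnitaryGroup.cmDatum L 2 (Matrix.of fun i j : Fin 2 => if i.val + j.val + 1 = 2 then (1 : L) else 0)).Local v × (UnitaryGroup.cmDatum L 1 (Matrix.of fun i j : Fin 1 => if i.val + j.val + 1 = 1 then (1 : L) else 0)).Local v,
        MeasurableSpace (((UnitaryGroup.cmDatum L 2 (Matrix.of fun i j : Fin 2 => if i.val + j.val + 1 = 2 then (1 : L) else 0)).Local v × (UnitaryGroup.cmDatum L 1 (Matrix.of fun i j : Fin 1 => if i.val + j.val + 1 = 1 then (1 : L) else 0)).Local v) ⧸ Subgroup.centralizer ({a} : Set ((UnitaryGroup.cmDatum L 2 (Matrix.of fun i j : Fin 2 => if i.val + j.val + 1 = 2 then (1 : L) else 0)).Local v × (UnitaryGroup.cmDatum L 1 (Matrix.of fun i j : Fin 1 => if i.val + j.val + 1 = 1 then (1 : L) else 0)).Local v)))]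
      [∀ a : (UnitaryGroup.cmDatum L 2 (Matrix.of fun i j : Fin 2 => if i.val + j.val + 1 = 2 then (1 : L) else 0)).Local v × (UnitaryGroup.cmDatum L 1 (Matrix.of fun i j : Fin 1 => if i.val + j.val + 1 = 1 then (1 : L) else 0)).Local v,
        BorelSpace (((UnitaryGroup.cmDatum L 2 (Matrix.of fun i j : Fin 2 => if i.val + j.val + 1 = 2 then (1 : L) else 0)).Local v × (UnitaryGroup.cmDatum L 1 (Matrix.of fun i j : Fin 1 => if i.val + j.val + 1 = 1 then (1 : L) else 0)).Local v) ⧸ Subgroup.centralizer ({a} : Set ((UnitaryGroup.cmDatum L 2 (Matrix.of fun i j : Fin 2 => if i.val + j.val + 1 = 2 then (1 : L) else 0)).Local v × (UnitaryGroup.cmDatum L 1 (Matrix.of fun i j : Fin 1 => if i.val + j.val + 1 = 1 then (1 : L) else 0)).Local v)))],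
      Subsingleton (UnitaryGroup.PlacesOver L v) →
    ∀ z : (UnitaryGroup.cmDatum L 2 (Matrix.of fun i j : Fin 2 => if i.val + j.val + 1 = 2 then (1 : L) else 0)).Local v × (UnitaryGroup.cmDatum L 1 (Matrix.of fun i j : Fin 1 => if i.val + j.val + 1 = 1 then (1 : L) else 0)).Local v, z ∈ Subgroup.center ((UnitaryGroup.cmDatum L 2 (Matrix.of fun i j : Fin 2 => if i.val + j.val + 1 = 2 then (1 : L) else 0)).Local v × (UnitaryGroup.cmDatum L 1 (Matrix.of fun i j : Fin 1 => if i.val + j.val + 1 = 1 then (1 : L) else 0)).Local v) →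
    ∀ γ : (UnitaryGroup.cmDatum L 2 (Matrix.of fun i j : Fin 2 => if i.val + j.val + 1 = 2 then (1 : L) else 0)).Local v × (UnitaryGroup.cmDatum L 1 (Matrix.of fun i j : Fin 1 => if i.val + j.val + 1 = 1 then (1 : L) else 0)).Local v,
      (((((γ * z⁻¹).1).val : GL (Fin 2) (UnitaryGroup.LocalRing L v)).val - 1) ^ 2 = 0 ∧ (γ * z⁻¹).2 = 1) →
    ∀ (μ : Measure (((UnitaryGroup.cmDatum L 2 (Matrix.of fun i j : Fin 2 => if i.val + j.val + 1 = 2 then (1 : L) else 0)).Local v × (UnitaryGroup.cmDatum L 1 (Matrix.of fun i j : Fin 1 => if i.val + j.val + 1 = 1 then (1 : L) else 0)).Local v) ⧸ Subgroup.centralizer ({γ} : Set ((UnitaryGroup.cmDatum L 2 (Matrix.of fun i j : Fin 2 => if i.val + j.val + 1 = 2 then (1 : L) else 0)).Local v × (UnitaryGroup.cmDatum L 1 (Matrix.of fun i j : Fin 1 => if i.val + j.val + 1 = 1 then (1 : L) else 0)).Local v))))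
      [SMulInvariantMeasure ((UnitaryGroup.cmDatum L 2 (Matrix.of fun i j : Fin 2 => if i.val + j.val + 1 = 2 then (1 : L) else 0)).Local v × (UnitaryGroup.cmDatum L 1 (Matrix.of fun i j : Fin 1 => if i.val + j.val + 1 = 1 then (1 : L) else 0)).Local v) (((UnitaryGroup.cmDatum L 2 (Matrix.of fun i j : Fin 2 => if i.val + j.val + 1 = 2 then (1 : L) else 0)).Local v × (UnitaryGroup.cmDatum L 1 (Matrix.of fun i j : Fin 1 => if i.val + j.val + 1 = 1 then (1 : L) else 0)).Local v) ⧸ Subgroup.centralizer ({γ} : Set ((UnitaryGroup.cmDatum L 2 (Matrix.of fun i j : Fin 2 => if i.val + j.val + 1 = 2 then (1 : L) else 0)).Local v × (UnitaryGroup.cmDatum L 1 (Matrix.of fun i j : Fin 1 => if i.val + j.val + 1 = 1 then (1 : L) else 0)).Local v))) μ] [IsFiniteMeasureOnCompacts μ],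
    ∀ fH : (UnitaryGroup.cmDatum L 2 (Matrix.of fun i j : Fin 2 => if i.val + j.val + 1 = 2 then (1 : L) else 0)).Local v × (UnitaryGroup.cmDatum L 1 (Matrix.of fun i j : Fin 1 => if i.val + j.val + 1 = 1 then (1 : L) else 0)).Local v → ℂ, IsLocSmooth fH →
      Integrable (descConj γ (Subgroup.centralizer ({γ} : Set ((UnitaryGroup.cmDatum L 2 (Matrix.of fun i j : Fin 2 => if i.val + j.val + 1 = 2 then (1 : L) else 0)).Local v × (UnitaryGroup.cmDatum L 1 (Matrix.of fun i j : Fin 1 => if i.val + j.val + 1 = 1 then (1 : L) else 0)).Local v))) (fun _ hg => Subgroup.mem_centralizer_singleton_iff.1 hg) fH) μ :=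
  Literature.NumberTheory.Rogawski1990.centralUnipotentOrbitalIntegrable_of_core
    Literature.NumberTheory.Rogawski1990.UnitaryGroup.measure_preimage_descConj_lt_top_of_coe_eq_lineUnipotent_central

end Summit.HodgeConjecture.HodgeConjecture.Cruxes.H413.K2E3EllipticInputs.U3bCentralGerms

end
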